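import Mathlib
import Summits.ValiantsHypothesis.ValiantsHypothesis.Theorems.NewtonUnitEquationsNewtonTauWeakAutomatonGenDefs
import Summits.ValiantsHypothesis.ValiantsHypothesis.Theorems.NewtonUnitEquationsNewtonTauWeakAutomatonCoeff

/-!
# `NewtonUnitEquationsNewtonTauWeakAutomatonGenCoeff` — general carry automaton: correctness of the transfer matrices

Rung toward `stub_binomialNewtonTauCommon` (crux `NewtonTauWeak`, stmt-ValiantsHypothesis-5904), line
`binomial-normal-form`, GENERAL CARRY AUTOMATON (Theorem B): registered stub `stub_genCoeff`.

Claim.  For level polynomials `G i` of degree `≤ C` in each variable, digits `P ∈ [0, 2^n)²` and a final carry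
`t ∈ {0..C}²`, the coefficient of `Π_{i<n} G_i(x^{2^i}, y^{2^i})` (`genProd G n`) at the position `2^n t + P` is the
`((0,0), t)` entry of the ordered product `genN C G 0 n P` of the carry transfer matrices `genT C (G i) p_i q_i`.

Proof.  Induction on `n`, for ALL final carries `k ∈ ℕ²` at once (the entry being read as `0` when `k ∉ {0..C}²`:
`coeff_genProd_aux`), peeling the top level: `genProd G (n+1) = genProd G n · G_n(x^{2^n}, y^{2^n})`
(`Finset.prod_range_succ`) and `genN … (n+1) = genN … n · genT …` (`List.range'_concat`).  The top factor is the sum of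
its monomials `G_n[u] x^{2^n u₀} y^{2^n u₁}` (`MvPolynomial.as_sum`, `MvPolynomial.expand_monomial`); the coefficient of a
product with a monomial is a shifted coefficient (`AutoCoeffAux.coeff_mul_pairMonomial`); with `P' = 2^n D + R`
(`D ∈ {0,1}²` the top digits) the shift `2^{n+1} k + P' - 2^n u = 2^n (2k + D - u) + R` is again of the shape of the
induction hypothesis, with new final carry `κ = 2k + D - u`, i.e. `u = 2κ' + D - κ` read backwards — exactly the
transition rule of `genT`; carries `> C` contribute `0` because `deg G_n ≤ C`.  The low product only reads the digits
below `n` (`genN_congr`). [folklore: carry automaton / transfer matrices of digit expansions]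
-/

set_option linter.dupNamespace false

noncomputable section

open scoped BigOperators
open MvPolynomial

namespace Summit.ValiantsHypothesis.ValiantsHypothesis.Theorems.NewtonTauWeakAutomaton

namespace GenCoeffAux

open AutoCoeffAux

/-! ## Peeling the top level -/

/-- `genProd` with one more level: the top factor splits off. -/
theorem genProd_succ (G : ℕ → MvPolynomial (Fin 2) ℂ) (n : ℕ) :
    genProd G (n + 1) = genProd G n * expand (2 ^ n) (G n) := by
  unfold genProd
  rw [Finset.prod_range_succ]

/-- `genN` over the levels `[0, n+1)`: the top transfer matrix splits off on the right. -/
theorem genN_succ (C : ℕ) (G : ℕ → MvPolynomial (Fin 2) ℂ) (n p q : ℕ) :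
    genN C G 0 (n + 1) (p, q) = genN C G 0 n (p, q) * genT C (G n) (p.testBit n).toNat (q.testBit n).toNat := by
  unfold genN
  rw [List.range'_concat, List.map_append, List.prod_append, List.map_singleton, List.prod_singleton]
  simp

/-- `genN C G 0 n (p, q)` only depends on the binary digits of `p, q` below `n`. -/
theorem genN_congr (C : ℕ) (G : ℕ → MvPolynomial (Fin 2) ℂ) (n p q p' q' : ℕ) (h1 : p % 2 ^ n = p' % 2 ^ n)
    (h2 : q % 2 ^ n = q' % 2 ^ n) : genN C G 0 n (p, q) = genN C G 0 n (p', q') := by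
  unfold genN
  congr 1
  apply List.map_congr_left
  intro i hi
  rw [List.mem_range'_1] at hi
  have hi' : i < n := by omega
  have e1 : p.testBit i = p'.testBit i := by
    have := congrArg (fun x => Nat.testBit x i) h1
    simpa [Nat.testBit_mod_two_pow, hi'] using this
  have e2 : q.testBit i = q'.testBit i := by
    have := congrArg (fun x => Nat.testBit x i) h2
    simpa [Nat.testBit_mod_two_pow, hi'] using this
  simp only [e1, e2]

/-! ## Digit arithmetic -/

/-- Splitting off the top binary digit: a number `< 2^{n+1}` is `2^n D + R` with `D < 2`, `R < 2^n`. -/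
theorem exists_digit (p n : ℕ) (hp : p < 2 ^ (n + 1)) : ∃ D R : ℕ, D < 2 ∧ R < 2 ^ n ∧ p = 2 ^ n * D + R := by
  refine ⟨p / 2 ^ n, p % 2 ^ n, ?_, Nat.mod_lt _ (by positivity), (Nat.div_add_mod p (2 ^ n)).symm⟩
  rw [Nat.div_lt_iff_lt_mul (by positivity)]
  calc p < 2 ^ (n + 1) := hp
    _ = 2 * 2 ^ n := by ring

/-- The top digit of `2^n D + R` (`D < 2`, `R < 2^n`) is `D`. -/
theorem testBit_top (n D R : ℕ) (hD : D < 2) (hR : R < 2 ^ n) : ((2 ^ n * D + R).testBit n).toNat = D := by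
  rw [Nat.toNat_testBit, Nat.mul_add_div (by positivity), Nat.div_eq_of_lt hR, add_zero, Nat.mod_eq_of_lt hD]

/-- Digit bookkeeping: `2^n u ≤ 2^{n+1} k + 2^n D + R` iff `u ≤ 2k + D` (for `R < 2^n`). -/
theorem le_pos_iff (n k D R u : ℕ) (hR : R < 2 ^ n) :
    2 ^ n * u ≤ 2 ^ (n + 1) * k + (2 ^ n * D + R) ↔ u ≤ 2 * k + D := by
  have h2n : 0 < 2 ^ n := by positivity
  have e : 2 ^ (n + 1) * k + (2 ^ n * D + R) = 2 ^ n * (2 * k + D) + R := by ring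
  rw [e, mul_comm (2 ^ n) u, ← Nat.le_div_iff_mul_le h2n, Nat.mul_add_div h2n, Nat.div_eq_of_lt hR, add_zero]

/-- Digit bookkeeping: removing the level-`n` contribution `2^n u` leaves `2^n (2k + D - u) + R`. -/
theorem pos_sub (n k D R u : ℕ) (hu : u ≤ 2 * k + D) :
    2 ^ (n + 1) * k + (2 ^ n * D + R) - 2 ^ n * u = 2 ^ n * (2 * k + D - u) + R := by
  have e : 2 ^ (n + 1) * k + (2 ^ n * D + R) = 2 ^ n * (2 * k + D) + R := by ring
  have e2 : 2 ^ n * (2 * k + D - u) + 2 ^ n * u = 2 ^ n * (2 * k + D) := by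
    rw [← mul_add, Nat.sub_add_cancel hu]
  rw [e]
  omega

/-! ## Expanding the top level into its monomials -/

/-- The top factor expanded: `G(x^{2^n}, y^{2^n}) = Σ_{u ∈ supp G} G[u] · x^{2^n u₀} y^{2^n u₁}`. -/
theorem expand_pow_eq_sum (F : MvPolynomial (Fin 2) ℂ) (n : ℕ) :
    expand (2 ^ n) F =
      ∑ u ∈ F.support, monomial (Finsupp.single 0 (2 ^ n * u 0) + Finsupp.single 1 (2 ^ n * u 1)) (coeff u F) := by
  conv_lhs => rw [F.as_sum]
  rw [map_sum]
  refine Finset.sum_congr rfl fun u _ => ?_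
  have hs : (2 ^ n • u : Fin 2 →₀ ℕ) = Finsupp.single 0 (2 ^ n * u 0) + Finsupp.single 1 (2 ^ n * u 1) := by
    rw [pair_eq_iff]
    simp
  rw [expand_monomial, hs]

/-! ## The induction -/

/-- Base of the induction (`n = 0`): both sides are `[k = (0,0)]`. -/
theorem base (C : ℕ) (G : ℕ → MvPolynomial (Fin 2) ℂ) (k0 k1 p q : ℕ) (hp : p < 2 ^ 0) (hq : q < 2 ^ 0) :
    coeff (Finsupp.single 0 (2 ^ 0 * k0 + p) + Finsupp.single 1 (2 ^ 0 * k1 + q)) (genProd G 0) =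
      ∑ κ : GSt C, if (κ.1 : ℕ) = k0 ∧ (κ.2 : ℕ) = k1 then genN C G 0 0 (p, q) (0, 0) κ else 0 := by
  have hp0 : p = 0 := by simpa using hp
  have hq0 : q = 0 := by simpa using hq
  subst hp0
  subst hq0
  have e1 : genProd G 0 = 1 := by simp [genProd]
  have e2 : genN C G 0 0 (0, 0) = 1 := by simp [genN]
  rw [e1, e2, coeff_one]
  simp only [pow_zero, one_mul, add_zero]
  rw [Finset.sum_eq_single ((0 : Fin (C + 1)), (0 : Fin (C + 1)))]
  · have e3 : ((0 : Fin 2 →₀ ℕ) = Finsupp.single 0 k0 + Finsupp.single 1 k1) ↔ k0 = 0 ∧ k1 = 0 := by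
      rw [pair_eq_iff]
      simp [eq_comm]
    simp only [e3, Matrix.one_apply_eq, Fin.val_zero]
    split_ifs <;> first | (exfalso; omega) | rfl
  · intro κ _ hne
    rw [Matrix.one_apply_ne' hne]
    simp
  · intro h
    exact absurd (Finset.mem_univ _) h

/-- One term of the induction step (fixed level-`n` contribution `u` with weight `a`): the shifted coefficient, evaluated
by the induction hypothesis, is the `u`-part of `(genN · genT)((0,0), k)`. -/
theorem step_term (C : ℕ) (G : ℕ → MvPolynomial (Fin 2) ℂ) (n : ℕ)
    (ih : ∀ (k0 k1 p q : ℕ), p < 2 ^ n → q < 2 ^ n →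
      coeff (Finsupp.single 0 (2 ^ n * k0 + p) + Finsupp.single 1 (2 ^ n * k1 + q)) (genProd G n) =
        ∑ κ : GSt C, if (κ.1 : ℕ) = k0 ∧ (κ.2 : ℕ) = k1 then genN C G 0 n (p, q) (0, 0) κ else 0)
    (k0 k1 D0 R0 D1 R1 : ℕ) (hR0 : R0 < 2 ^ n) (hR1 : R1 < 2 ^ n) (u : Fin 2 →₀ ℕ) (a : ℂ) :
    (if 2 ^ n * u 0 ≤ 2 ^ (n + 1) * k0 + (2 ^ n * D0 + R0) ∧ 2 ^ n * u 1 ≤ 2 ^ (n + 1) * k1 + (2 ^ n * D1 + R1) then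
        coeff (Finsupp.single 0 (2 ^ (n + 1) * k0 + (2 ^ n * D0 + R0) - 2 ^ n * u 0) +
            Finsupp.single 1 (2 ^ (n + 1) * k1 + (2 ^ n * D1 + R1) - 2 ^ n * u 1)) (genProd G n) * a
      else 0) =
    ∑ κ : GSt C, genN C G 0 n (R0, R1) (0, 0) κ *
      (if (κ.1 : ℕ) ≤ 2 * k0 + D0 ∧ (κ.2 : ℕ) ≤ 2 * k1 + D1 ∧
          u = Finsupp.single 0 (2 * k0 + D0 - κ.1) + Finsupp.single 1 (2 * k1 + D1 - κ.2) then a else 0) := by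
  simp only [le_pos_iff n k0 D0 R0 (u 0) hR0, le_pos_iff n k1 D1 R1 (u 1) hR1]
  by_cases hA : u 0 ≤ 2 * k0 + D0 ∧ u 1 ≤ 2 * k1 + D1
  · rw [if_pos hA, pos_sub n k0 D0 R0 (u 0) hA.1, pos_sub n k1 D1 R1 (u 1) hA.2,
      ih (2 * k0 + D0 - u 0) (2 * k1 + D1 - u 1) R0 R1 hR0 hR1, Finset.sum_mul]
    refine Finset.sum_congr rfl fun κ _ => ?_
    simp only [pair_eq_iff]
    obtain ⟨hA1, hA2⟩ := hA
    split_ifs with h h' h' <;> first | (exfalso; omega) | ring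
  · rw [if_neg hA]
    symm
    refine Finset.sum_eq_zero fun κ _ => ?_
    simp only [pair_eq_iff]
    rw [if_neg, mul_zero]
    rintro ⟨-, -, h3, h4⟩
    exact hA ⟨by omega, by omega⟩

/-- The induction step, assembled: summing the `u`-parts over the monomials `u` of the top factor gives
`[k ∈ {0..C}²] · (genN over n+1 levels)((0,0), k)` (reindex `u ↔ κ`, `Matrix.mul_apply`; carries `> C` contribute `0`
since `deg G_n ≤ C`). -/
theorem assemble (C : ℕ) (G : ℕ → MvPolynomial (Fin 2) ℂ) (hG : ∀ i, ∀ e ∈ (G i).support, e 0 ≤ C ∧ e 1 ≤ C)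
    (n k0 k1 D0 R0 D1 R1 : ℕ) (hD0 : D0 < 2) (hD1 : D1 < 2) (hR0 : R0 < 2 ^ n) (hR1 : R1 < 2 ^ n) :
    (∑ u ∈ (G n).support, ∑ κ : GSt C, genN C G 0 n (R0, R1) (0, 0) κ *
      (if (κ.1 : ℕ) ≤ 2 * k0 + D0 ∧ (κ.2 : ℕ) ≤ 2 * k1 + D1 ∧
          u = Finsupp.single 0 (2 * k0 + D0 - κ.1) + Finsupp.single 1 (2 * k1 + D1 - κ.2) then
        coeff u (G n) else 0)) =
    ∑ τ : GSt C, if (τ.1 : ℕ) = k0 ∧ (τ.2 : ℕ) = k1 then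
      genN C G 0 (n + 1) (2 ^ n * D0 + R0, 2 ^ n * D1 + R1) (0, 0) τ else 0 := by
  rw [Finset.sum_comm]
  have inner : ∀ κ : GSt C, (∑ u ∈ (G n).support, genN C G 0 n (R0, R1) (0, 0) κ *
      (if (κ.1 : ℕ) ≤ 2 * k0 + D0 ∧ (κ.2 : ℕ) ≤ 2 * k1 + D1 ∧
          u = Finsupp.single 0 (2 * k0 + D0 - κ.1) + Finsupp.single 1 (2 * k1 + D1 - κ.2) then
        coeff u (G n) else 0)) =
      genN C G 0 n (R0, R1) (0, 0) κ *
        (if (κ.1 : ℕ) ≤ 2 * k0 + D0 ∧ (κ.2 : ℕ) ≤ 2 * k1 + D1 then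
          coeff (Finsupp.single 0 (2 * k0 + D0 - κ.1) + Finsupp.single 1 (2 * k1 + D1 - κ.2)) (G n) else 0) := by
    intro κ
    rw [← Finset.mul_sum]
    congr 1
    by_cases hle : (κ.1 : ℕ) ≤ 2 * k0 + D0 ∧ (κ.2 : ℕ) ≤ 2 * k1 + D1
    · rw [if_pos hle]
      have hs : ∀ u ∈ (G n).support,
          (if (κ.1 : ℕ) ≤ 2 * k0 + D0 ∧ (κ.2 : ℕ) ≤ 2 * k1 + D1 ∧
              u = Finsupp.single 0 (2 * k0 + D0 - κ.1) + Finsupp.single 1 (2 * k1 + D1 - κ.2) then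
            coeff u (G n) else 0) =
          (if u = Finsupp.single 0 (2 * k0 + D0 - κ.1) + Finsupp.single 1 (2 * k1 + D1 - κ.2) then
            coeff u (G n) else 0) := by
        intro u _
        simp only [hle, true_and]
      rw [Finset.sum_congr rfl hs, Finset.sum_ite_eq']
      split_ifs with hmem
      · rfl
      · exact (notMem_support_iff.mp hmem).symm
    · rw [if_neg hle]
      refine Finset.sum_eq_zero fun u _ => ?_
      rw [if_neg]
      intro h
      exact hle ⟨h.1, h.2.1⟩
  rw [Finset.sum_congr rfl fun κ _ => inner κ, genN_succ, testBit_top n D0 R0 hD0 hR0,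
    testBit_top n D1 R1 hD1 hR1,
    genN_congr C G n (2 ^ n * D0 + R0) (2 ^ n * D1 + R1) R0 R1 (Nat.mul_add_mod _ _ _) (Nat.mul_add_mod _ _ _)]
  by_cases hk : k0 ≤ C ∧ k1 ≤ C
  · symm
    rw [Finset.sum_eq_single
      ((⟨k0, Nat.lt_succ_of_le hk.1⟩ : Fin (C + 1)), (⟨k1, Nat.lt_succ_of_le hk.2⟩ : Fin (C + 1)))]
    · rw [if_pos ⟨rfl, rfl⟩, Matrix.mul_apply]
      refine Finset.sum_congr rfl fun κ _ => ?_
      simp only [genT]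
    · intro τ _ hne
      rw [if_neg]
      intro h
      exact hne (Prod.ext (Fin.ext h.1) (Fin.ext h.2))
    · intro h
      exact absurd (Finset.mem_univ _) h
  · have rhs0 : ∀ τ : GSt C, ¬ ((τ.1 : ℕ) = k0 ∧ (τ.2 : ℕ) = k1) := by
      intro τ h
      have := τ.1.isLt
      have := τ.2.isLt
      omega
    simp only [rhs0, if_false, Finset.sum_const_zero]
    refine Finset.sum_eq_zero fun κ _ => ?_
    split_ifs with hle
    · rw [notMem_support_iff.mp, mul_zero]
      intro hmem
      have hb := hG n _ hmem
      rw [pair_apply_zero, pair_apply_one] at hb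
      have := κ.1.isLt
      have := κ.2.isLt
      omega
    · exact mul_zero _

/-- **The induction** (automaton correctness for all final carries `k ∈ ℕ²` at once): the coefficient of `genProd G n`
at `2^n k + (p, q)` (`p, q < 2^n`) is the `((0,0), k)` entry of `genN C G 0 n (p, q)` if `k ∈ {0..C}²`, else `0`. -/
theorem coeff_genProd_aux (C : ℕ) (G : ℕ → MvPolynomial (Fin 2) ℂ)
    (hG : ∀ i, ∀ e ∈ (G i).support, e 0 ≤ C ∧ e 1 ≤ C) (n : ℕ) :
    ∀ (k0 k1 p q : ℕ), p < 2 ^ n → q < 2 ^ n →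
      coeff (Finsupp.single 0 (2 ^ n * k0 + p) + Finsupp.single 1 (2 ^ n * k1 + q)) (genProd G n) =
        ∑ κ : GSt C, if (κ.1 : ℕ) = k0 ∧ (κ.2 : ℕ) = k1 then genN C G 0 n (p, q) (0, 0) κ else 0 := by
  induction n with
  | zero =>
    intro k0 k1 p q hp hq
    exact base C G k0 k1 p q hp hq
  | succ n ih =>
    intro k0 k1 p q hp hq
    obtain ⟨D0, R0, hD0, hR0, rfl⟩ := exists_digit p n hp
    obtain ⟨D1, R1, hD1, hR1, rfl⟩ := exists_digit q n hq
    rw [genProd_succ, expand_pow_eq_sum, Finset.mul_sum, coeff_sum]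
    have step1 : ∀ u : Fin 2 →₀ ℕ,
        coeff (Finsupp.single 0 (2 ^ (n + 1) * k0 + (2 ^ n * D0 + R0)) +
            Finsupp.single 1 (2 ^ (n + 1) * k1 + (2 ^ n * D1 + R1)))
          (genProd G n * monomial (Finsupp.single 0 (2 ^ n * u 0) + Finsupp.single 1 (2 ^ n * u 1)) (coeff u (G n))) =
        ∑ κ : GSt C, genN C G 0 n (R0, R1) (0, 0) κ *
          (if (κ.1 : ℕ) ≤ 2 * k0 + D0 ∧ (κ.2 : ℕ) ≤ 2 * k1 + D1 ∧
              u = Finsupp.single 0 (2 * k0 + D0 - κ.1) + Finsupp.single 1 (2 * k1 + D1 - κ.2) then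
            coeff u (G n) else 0) := by
      intro u
      rw [coeff_mul_pairMonomial]
      exact step_term C G n ih k0 k1 D0 R0 D1 R1 hR0 hR1 u (coeff u (G n))
    rw [Finset.sum_congr rfl fun u _ => step1 u]
    exact assemble C G hG n k0 k1 D0 R0 D1 R1 hD0 hD1 hR0 hR1

end GenCoeffAux

open GenCoeffAux

/-- **General carry automaton: correctness.**  For level polynomials `G i` of degree `≤ C` in each variable
(`hG`), digits `P ∈ [0, 2^n)²` and a final carry `t ∈ {0..C}²`, the coefficient of
`genProd G n = Π_{i<n} G_i(x^{2^i}, y^{2^i})` at the position `2^n t + P` is the `((0,0), t)` entry of the ordered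
product `genN C G 0 n P` of the carry transfer matrices `genT C (G i) p_i q_i` (`p_i, q_i` the binary digits of `P`).
Induction on `n` peeling the top level (`GenCoeffAux.coeff_genProd_aux`). [folklore: carry automaton] -/
theorem stub_genCoeff (C : ℕ) (G : ℕ → MvPolynomial (Fin 2) ℂ) (hG : ∀ i, ∀ e ∈ (G i).support, e 0 ≤ C ∧ e 1 ≤ C)
    (n : ℕ) (t : Fin (C + 1) × Fin (C + 1)) (P : ℕ × ℕ) (hP : P.1 < 2 ^ n ∧ P.2 < 2 ^ n) :
    coeff (Finsupp.single 0 (2 ^ n * (t.1 : ℕ) + P.1) + Finsupp.single 1 (2 ^ n * (t.2 : ℕ) + P.2)) (genProd G n) =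
      genN C G 0 n P ((0 : Fin (C + 1)), (0 : Fin (C + 1))) t := by
  rw [coeff_genProd_aux C G hG n t.1 t.2 P.1 P.2 hP.1 hP.2, Finset.sum_eq_single t]
  · rw [if_pos ⟨rfl, rfl⟩]
  · intro κ _ hne
    rw [if_neg]
    intro h
    exact hne (Prod.ext (Fin.ext h.1) (Fin.ext h.2))
  · intro h
    exact absurd (Finset.mem_univ _) h

end Summit.ValiantsHypothesis.ValiantsHypothesis.Theorems.NewtonTauWeakAutomaton

end
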